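import Literature.AnabelianGeometry.EtaleTheta.Discharge.Sec3TemperedFrobenioidDivisorAutOfOverBase
import Literature.IUT.HodgeTheaters.Cor53iModelRatioTransport
import HarnessLib

/-!
# [EtTh] Def. 3.6 tempered Frobenioids: the extraction Prop `SelfEquivInducesDataAutRatio` (★ p530466) of the [IUTchI] Cor. 5.3 (iv)
# telescope FOLLOWS from the [FrdI] standing hypotheses BY NAME — [FrdI] Cor. 4.10 / Cor. 4.11 (iv) / Thm. 5.2 (ii) at the model

S. Mochizuki, *The geometry of Frobenioids I*, Kyushu J. Math. **62** (2008): Cor. 4.10 p. 90 (`Ψ^birat`), Cor. 4.11 (ii)–(iv)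
pp. 91–92 (`Ψ^Base`, `Ψ^Φ`, `Div(Ψ φ) = η^* Ψ^Φ(Div φ)`), Thm. 5.2 (i)–(ii) pp. 100–101 (the model category, relation (d)
`deg_Fr(φ)·α + Div(φ) = Base(φ)^*β + Div_B(u_φ)`; «compatible with `Div_B`») [cite: MochizukiFrdI2008, Cor. 4.10 p.90]
[cite: MochizukiFrdI2008, Thm. 5.2 (ii) p.101]; S. Mochizuki, *The étale theta function …*, Publ. RIMS **45** (2009), Def. 3.6 p. 77
[cite: MochizukiEtTh2009, Def 3.6 p.77] (the tempered Frobenioid IS the model Frobenioid of its data `(D, Φ, B, Div_B)` — abc-iut-L2-t3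
`TemperedFrobenioid.category`).  Consumer locus: [IUTchI] Cor. 5.3 (iv) pp. 144–145 ([IUTchI] Cor 5.3 (iv) p.144)
[claim: Mochizuki2012, status: disputed] (nothing of the series asserted; no side taken on [IUTchIII] Cor. 3.12).

PROOF-ONLY knit (cell abc-iut; author abc-iut-L5-t1 gen 13, offer (α) «HIND-RATIO-DISCHARGE@MODEL», half (α2); L5-lead RULINGS #166 (3),
L2-lead R1486 custody; sizing memo HOME/staging/L5/L5-t1/g13/HIND-RATIO-DISCHARGE-SIZING.md).

* **`TemperedFrobenioid.selfEquivInducesDataAutRatio_of_hypotheses`** — `C.SelfEquivInducesDataAutRatio` (abc-iut-L5-t1 ★ p530466: every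
  self-equivalence `Ψ` of `C.category` over the identity of `D` moves zero divisors through a data automorphism `(a, b)` of `(Φ, B, Div_B)`
  and a base identification `η`, with the RATIO law on the birational units of parallel linear pairs) from EXACTLY the six standing [FrdI]
  hypotheses of the (iv) files (Thm 5.2 `Hypotheses`, `Φ` perf-factorial, `D` slim, `D` of FSMFF type, `Φ` non-dilating, `Φ` non-zero) plus
  the Def 4.5 (ii) rationality binder `hrat₁` at THE birationalization — NOTHING ELSE.
  ASSEMBLY, all BY NAME: `a := θ`, the NATURAL divisor-monoid automorphism over `𝟭_D` of the (Φ)-half ★ `exists_divisorAut_of_overBase`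
  (Cor 4.11 (iv) at the model, transported along the `1`-uniqueness `𝟭 ≅ Ψ^Base`) with its `η'`; `b := ᾱ`, abc-iut-L5-t11's ★
  `ModelFrobenioid.exists_unitsAut_of_selfEquivalence_over_baseIso` (Cor 4.10 / Thm 5.2 (ii): natural `ᾱ` on `B` with the ratio law through
  the SAME `η'`), whose Cor 4.10 hypotheses are discharged at `C.category` by [FrdI] Thm 3.4 (ii) (`FrdI.thm34ii_ofFunctor` at
  `cor411Setting_model_of_not_isZeroMonoid`: `Ψ^{±1}` preserve co-angular pre-steps), Thm 5.2 (ii) (`ModelFrobenioid.isOfIsotropicType`),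
  Cor 4.11 (iii) (`FrdI.exists_divisorMonoidIsoOver_div_ofFunctor`: `Ψ^Φ` over `Ψ`; `FrdI.preservesDegFr_of_cor411Setting`).
  THE ONE NEW STEP (the `Div_B`-compatibility `Div_B ∘ b_A = a_A^gp ∘ Div_B` of the data automorphism, for THIS natural `a = θ` rather than
  the opaque object-wise `ε_A` of t11's clause (2)): it follows from the (Φ)-clause and the ratio law THEMSELVES, applied to the parallel
  linear pair `f = (1, id_A, P, u)`, `g = (1, id_A, N, 1) : (A, 0) → (A, [N])` of Thm 5.2 (i) with `Div_B(u) = [P] − [N]`, through relation (d)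
  for `Ψ f`, `Ψ g` and the injectivity of the pull-back along the isomorphism `η'_X`.

HONEST LABELS.  OUR theorem about OUR model carrier (the [EtTh] Def 3.6 category literally IS [FrdI]'s model category here).  An extraction
re-labels a displayed binder of the (iv) telescope (abc-iut-L5-t1 ★ `Cor53iv.tempered_descendBijective_of_divisorDataRigidRatio_of_dataAction`):
after this file its injectivity half rests on `{six [FrdI] standing hyps, hrat₁, DivisorDataRigid}`; `DivisorDataRigid` ([EtTh] Thm 5.6 content)
stays DISPLAYED and is KNOWN FALSE AS TYPED at the design carrier `temperedFrobenioidSmall` (★ `not_divisorDataRigid_temperedFrobenioidSmall`,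
abc-iut-f-193) — nothing is instantiated there.  No definitions, no instances; typed ≠ inhabited ≠ proved; nothing here asserts abc proved
or refuted.
-/

noncomputable section

set_option backward.isDefEq.respectTransparency false

namespace Literature.AnabelianGeometry.EtaleTheta

open CategoryTheory Opposite Literature.AlgebraicGeometry.Frobenioids Literature.IUT.HodgeTheaters
open Literature.AlgebraicGeometry.Frobenioids.PreFrobenioid Literature.AlgebraicGeometry.Frobenioids.PreFrobenioidData

namespace TemperedFrobenioid

universe u₀ v₀ u v w

variable {D₀ : Type u₀} [Category.{v₀} D₀] {V : FrdIMonoidStub.{w}}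
  {T : RealifiedDivisorMonoids (D₀ := D₀) V} {D : Type u} [Category.{v} D]
  {VD : FrdICatStub.{u, v, w} D} (C : TemperedFrobenioid T D VD)

/-- Every element of a Grothendieck group is a quotient of two elements of the monoid. [folklore] -/
private theorem exists_eq_of_div_of' {M : Type*} [CommMonoid M] (x : Algebra.GrothendieckGroup M) :
    ∃ p n : M, x = Algebra.GrothendieckGroup.of p / Algebra.GrothendieckGroup.of n := by
  induction x using Localization.induction_on with
  | H q =>
    refine ⟨q.1, q.2, eq_div_iff_mul_eq'.mpr ?_⟩
    show Localization.mk q.1 q.2 * Localization.mk (q.2 : M) 1 = Localization.mk q.1 1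
    rw [Localization.mk_mul, Localization.mk_eq_mk_iff, Localization.r_iff_exists]
    exact ⟨1, by simp [mul_comm]⟩

/-- **[FrdI] Cor. 4.10 / Cor. 4.11 (iv) / Thm. 5.2 (ii) ⇒ the (iv)-telescope extraction Prop, BY NAME.**  For the [EtTh] Def 3.6 tempered
Frobenioid `C` under the six standing [FrdI] hypotheses (Thm 5.2 `Hypotheses`, `Φ` perf-factorial, `D` slim and of FSMFF type, `Φ`
non-dilating and non-zero) and the Def 4.5 (ii) rationality `hrat₁` at THE birationalization: `C.SelfEquivInducesDataAutRatio` — every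
self-equivalence `Ψ` of `C.category` over the identity of `D` admits `η : Ψ ⋙ Base ≅ Base` and a data automorphism `(a, b)` of `(Φ, B, Div_B)`
over `id_D` with `Div(Ψ φ) = η_X^* a(Div φ)` for every arrow and `u_{Ψ f} · η_X^*(b(u_g)) = u_{Ψ g} · η_X^*(b(u_f))` for parallel
linear `f, g`.
`a := θ` of ★ `exists_divisorAut_of_overBase` (Cor 4.11 (iv)), `b := ᾱ` of abc-iut-L5-t11's ★ `exists_unitsAut_of_selfEquivalence_over_baseIso`
(Cor 4.10 / Thm 5.2 (ii)) through the same `η`; the `Div_B`-compatibility of `(θ, ᾱ)` is READ OFF the two laws on the parallel linear pair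
`(1, id, P, u), (1, id, N, 1) : (A, 0) → (A, [N])` (`Div_B u = [P] − [N]`) via Thm 5.2 (i) relation (d).
[cite: MochizukiFrdI2008, Cor. 4.10 p.90] [cite: MochizukiFrdI2008, Thm. 5.2 (ii) p.101] [claim: Mochizuki2012, status: disputed] -/
theorem selfEquivInducesDataAutRatio_of_hypotheses
    (h : ModelFrobenioid.Hypotheses C.divisorMonoid C.ratFnFunctor)
    (hpf : Objectwise (fun M _ => IsPerfFactorial M) C.divisorMonoid) (hsl : IsSlim D) (hfs : IsOfFSMFFType D)
    (hnd : IsNonDilatingOn C.divisorMonoid) (hz : ¬ ModelFrobenioid.IsZeroMonoid C.divisorMonoid)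
    (hrat₁ : ∀ A : C.category, PreFrobenioidData.IsRational
      (biratData (h.isFrobenioid C.divisorMonoid C.ratFnFunctor C.divBNatTrans)
        (hasBiratSquares_of_isFrobenioid (h.isFrobenioid C.divisorMonoid C.ratFnFunctor C.divBNatTrans)))
      (S := ModelFrobenioid.data C.divisorMonoid C.ratFnFunctor C.divBNatTrans) (fun a 𝔭 => PrimarySupp a 𝔭) A) :
    C.SelfEquivInducesDataAutRatio := by
  intro Ψ hΨ
  -- (Φ): the NATURAL divisor-monoid automorphism `θ` over `𝟭_D` and the base identification `η'` (Cor 4.11 (iv))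
  obtain ⟨θ, η', hθ⟩ := C.exists_divisorAut_of_overBase h hpf hsl hfs hnd hz hrat₁ Ψ hΨ
  -- the [FrdI] Cor 4.10 hypotheses at `C.category`, BY NAME
  have hF := h.isFrobenioid C.divisorMonoid C.ratFnFunctor C.divBNatTrans
  have hs := ModelFrobenioid.cor411Setting_model_of_not_isZeroMonoid (DivB₁ := C.divBNatTrans) (DivB₂ := C.divBNatTrans)
    h h hsl hsl hfs hfs hnd hnd hz hz Ψ
  obtain ⟨-, hca, -⟩ := FrdI.thm34ii_ofFunctor hF hF Ψ hs.standard.1.quasiIsotropic hs.standard.2.quasiIsotropic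
    hs.standard.1.fsmff hs.standard.2.fsmff
  obtain ⟨-, hca', -⟩ := FrdI.thm34ii_ofFunctor hF hF Ψ.symm hs.standard.2.quasiIsotropic hs.standard.1.quasiIsotropic
    hs.standard.2.fsmff hs.standard.1.fsmff
  have hΨc : ∀ ⦃A A' : C.category⦄ (f : A ⟶ A'),
      PreFrobenioid.IsCoAngularPreStep (ModelFrobenioid.toElem _ _ C.divBNatTrans) f →
        PreFrobenioid.IsCoAngularPreStep (ModelFrobenioid.toElem _ _ C.divBNatTrans) (Ψ.functor.map f) :=
    fun A A' f hf => (PreFrobenioidData.ofFunctor_isCoAngularPreStep _ _).mp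
      (hca f ((PreFrobenioidData.ofFunctor_isCoAngularPreStep _ _).mpr hf))
  have hΨc' : ∀ ⦃A A' : C.category⦄ (f : A ⟶ A'),
      PreFrobenioid.IsCoAngularPreStep (ModelFrobenioid.toElem _ _ C.divBNatTrans) f →
        PreFrobenioid.IsCoAngularPreStep (ModelFrobenioid.toElem _ _ C.divBNatTrans) (Ψ.inverse.map f) :=
    fun A A' f hf => (PreFrobenioidData.ofFunctor_isCoAngularPreStep _ _).mp
      (hca' f ((PreFrobenioidData.ofFunctor_isCoAngularPreStep _ _).mpr hf))
  obtain ⟨ΨΦ, hdiv⟩ := FrdI.exists_divisorMonoidIsoOver_div_ofFunctor hF hF hpf hpf hrat₁ Ψ hs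
  have hdeg : ∀ ⦃X Y : C.category⦄ (φ : X ⟶ Y), ModelFrobenioid.degFr (Ψ.functor.map φ) = ModelFrobenioid.degFr φ :=
    FrdI.preservesDegFr_of_cor411Setting hF hF Ψ hs
  -- (B): t11's natural `ᾱ` with the ratio law through the SAME `η'` (Cor 4.10 / Thm 5.2 (ii))
  obtain ⟨ᾱ, hnat, -, hratio⟩ := ModelFrobenioid.exists_unitsAut_of_selfEquivalence_over_baseIso h.isGroupLike_rat
    h.isDivisorial hF (ModelFrobenioid.isOfIsotropicType h.isGroupLike_rat) Ψ hΨc hΨc' hdeg ΨΦ hdiv η'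
  -- base arrows of `Ψ φ` through `η'`
  have hbase : ∀ ⦃X Y : C.category⦄ (φ : X ⟶ Y),
      ModelFrobenioid.baseMap (Ψ.functor.map φ) = η'.hom.app X ≫ ModelFrobenioid.baseMap φ ≫ η'.inv.app Y :=
    fun X Y φ => ModelFrobenioid.baseMap_map_eq_of_overBase Ψ (fun X => η'.app X) (fun _ _ φ => η'.hom.naturality φ) φ
  have hinj : ∀ X : C.category, Function.Injective (pullGp C.divisorMonoid (η'.hom.app X)) := by
    intro X a₁ a₂ hyp
    have h' := congrArg (pullGp C.divisorMonoid (η'.inv.app X)) hyp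
    rwa [← pullGp_comp, ← pullGp_comp, Iso.inv_hom_id_app, pullGp_id, pullGp_id] at h'
  -- the divisor half `a := θ` of the data automorphism, indexed by `Dᵒᵖ`
  let a : ∀ A : Dᵒᵖ, (C.divisorMonoid.obj A : Type w) ≃* (C.divisorMonoid.obj A : Type w) := fun A => θ.iso (unop A)
  -- THE GLUE: `Div_B (ᾱ_A u) = θ_A^gp (Div_B u)`
  have glue : ∀ (A : D) (u : C.ratFnFunctor.obj (op A)),
      Literature.AlgebraicGeometry.Frobenioids.divB C.divisorMonoid C.ratFnFunctor C.divBNatTrans (op A) (ᾱ A u) =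
        MonGp.map (a (op A)).toMonoidHom
          (Literature.AlgebraicGeometry.Frobenioids.divB C.divisorMonoid C.ratFnFunctor C.divBNatTrans (op A) u) := by
    intro A u
    obtain ⟨P, N, hPN⟩ :=
      exists_eq_of_div_of' (Literature.AlgebraicGeometry.Frobenioids.divB C.divisorMonoid C.ratFnFunctor C.divBNatTrans (op A) u)
    -- the parallel linear pair `f = (1, id, P, u)`, `g = (1, id, N, 1) : (A, 0) → (A, [N])`
    let X : C.category := ⟨A, 1⟩
    let Y : C.category := ⟨A, Algebra.GrothendieckGroup.of N⟩
    let f : X ⟶ Y :=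
      { degFr := 1, base := 𝟙 A, div := P, unit := u
        rel := by
          change (1 : Algebra.GrothendieckGroup (C.divisorMonoid.obj (op A))) ^ ((1 : ℕ+) : ℕ) * Algebra.GrothendieckGroup.of P =
            pullGp C.divisorMonoid (𝟙 A) (Algebra.GrothendieckGroup.of N) *
              Literature.AlgebraicGeometry.Frobenioids.divB C.divisorMonoid C.ratFnFunctor C.divBNatTrans (op A) u
          rw [one_pow, one_mul, pullGp_id, hPN, mul_div_cancel] }
    let g : X ⟶ Y :=
      { degFr := 1, base := 𝟙 A, div := N, unit := 1
        rel := by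
          change (1 : Algebra.GrothendieckGroup (C.divisorMonoid.obj (op A))) ^ ((1 : ℕ+) : ℕ) * Algebra.GrothendieckGroup.of N =
            pullGp C.divisorMonoid (𝟙 A) (Algebra.GrothendieckGroup.of N) *
              Literature.AlgebraicGeometry.Frobenioids.divB C.divisorMonoid C.ratFnFunctor C.divBNatTrans (op A) 1
          rw [one_pow, one_mul, pullGp_id, map_one, mul_one] }
    -- the ratio law and the (Φ)-clause on `f`, `g`
    have E1 := hratio f g rfl rfl rfl
    have hug : ModelFrobenioid.unit g = 1 := rfl
    rw [hug, map_one, map_one, mul_one] at E1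
    -- relation (d) for `Ψ f` and `Ψ g`
    have Rf := ModelFrobenioid.rel (Ψ.functor.map f)
    have Rg := ModelFrobenioid.rel (Ψ.functor.map g)
    have hbf : ModelFrobenioid.baseMap (Ψ.functor.map f) = ModelFrobenioid.baseMap (Ψ.functor.map g) := by
      rw [hbase f, hbase g]
    rw [hdeg f, hθ f, E1, hbf, map_mul, ← mul_assoc, ← Rg, hdeg g, hθ g] at Rf
    -- everything lives over `(Ψ X).base`, pulled back along the isomorphism `e := η'_X`
    let e : (Ψ.functor.obj X).base ⟶ A := η'.hom.app X
    have Rf₂ : (Ψ.functor.obj X).cls ^ ((1 : ℕ+) : ℕ) * Algebra.GrothendieckGroup.of (pull C.divisorMonoid e (θ.iso A P)) =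
        (Ψ.functor.obj X).cls ^ ((1 : ℕ+) : ℕ) * Algebra.GrothendieckGroup.of (pull C.divisorMonoid e (θ.iso A N)) *
          Literature.AlgebraicGeometry.Frobenioids.divB C.divisorMonoid C.ratFnFunctor C.divBNatTrans (op (Ψ.functor.obj X).base)
            (pull C.ratFnFunctor e (ᾱ A u)) := Rf
    rw [mul_assoc] at Rf₂
    have Rf' := mul_left_cancel Rf₂
    have hpo : ∀ x : C.divisorMonoid.obj (op A),
        Algebra.GrothendieckGroup.of (pull C.divisorMonoid e x) = pullGp C.divisorMonoid e (Algebra.GrothendieckGroup.of x) :=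
      fun x => (pullGp_of _ _).symm
    have hpd : Literature.AlgebraicGeometry.Frobenioids.divB C.divisorMonoid C.ratFnFunctor C.divBNatTrans (op (Ψ.functor.obj X).base)
          (pull C.ratFnFunctor e (ᾱ A u)) =
        pullGp C.divisorMonoid e
          (Literature.AlgebraicGeometry.Frobenioids.divB C.divisorMonoid C.ratFnFunctor C.divBNatTrans (op A) (ᾱ A u)) :=
      (pullGp_divB (B := C.ratFnFunctor) (DivB := C.divBNatTrans) _ _).symm
    rw [hpo, hpo, hpd, ← map_mul] at Rf'
    have key := hinj X Rf'
    rw [hPN, map_div, MonGp.map_of, MonGp.map_of, eq_div_iff_mul_eq', mul_comm]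
    exact key.symm
  -- the data automorphism `(θ, ᾱ)` and the two laws
  exact ⟨η', ⟨a, fun A => ᾱ (unop A), fun f x => θ.natural f x, fun f u => hnat f u, fun A u => glue (unop A) u⟩, hθ,
    fun X Y f g hf hg hfg => hratio f g hf hg hfg⟩

end TemperedFrobenioid

end Literature.AnabelianGeometry.EtaleTheta

end
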